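import Mathlib
import Literature.Probability.LatticeModels.ModifiedSimonInequality
import Literature.Probability.LatticeModels.LoopO1

/-!
# `StrandShadow` (item stmt-CriticalPhenomena-14626): cluster decomposition of `T`-joins

Standing crux disprover (refuter-cdisprove-stmt-CriticalPhenomena-14626-0), cycle 1 — SUPPORT file 1/2
behind the pair-split deletion identity (★) (file 2/2: `PairSplitDeletion.lean`).  No Theses decl is
concluded.

For an edge finset `F` of a finite graph and a vertex `x`: `Rch F x v` (reachability inside `F`),
`clusterEdges F x` (the edges of the `x`-component), `edeg F v` (the `F`-degree), the handshake
`even_card_odd_edeg`, the depleted volume `dVol K x = {v | ¬ x ↝_K v}`, and the FIBRE BIJECTION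
`fibre_sum`: over a fixed self-clustered `K` with odd set `S₀` and a terminal set `T ⊆ dVol K x`,
`F ↦ F ∖ K` maps `{F ∈ 𝒯_{S₀ ∪ T}(G) : clusterEdges F x = K}` bijectively onto the `T`-subgraphs of
the depleted volume (`R ⊆ edgesIn G (dVol K x)`, `oddVerts (dVol K x) R = T`), inverse `R ↦ K ∪ R`.
-/

noncomputable section

namespace Summit.CriticalPhenomena.Ising3DConformalLimit.StrandShadowNegative

open scoped BigOperators Classical
open Finset Literature.Probability.LatticeModels

section Graph
variable {V : Type*} [DecidableEq V]

/-- Reachability from `x` inside the edge finset `F`. [folklore] -/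
abbrev Rch (F : Finset (Sym2 V)) (x v : V) : Prop :=
  (SimpleGraph.fromEdgeSet (↑F : Set (Sym2 V))).Reachable x v

omit [DecidableEq V] in
/-- Every vertex is reachable from itself inside any edge set. [folklore] -/
theorem rch_refl (F : Finset (Sym2 V)) (x : V) : Rch F x x := SimpleGraph.Reachable.refl x

omit [DecidableEq V] in
/-- Reachability inside an edge set is monotone in the edge set. [folklore] -/
theorem rch_mono {F F' : Finset (Sym2 V)} (h : F ⊆ F') {x v : V} (hr : Rch F x v) : Rch F' x v :=
  SimpleGraph.Reachable.mono (SimpleGraph.fromEdgeSet_mono (Finset.coe_subset.2 h)) hr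

/-- One more edge of `F` at a reachable endpoint keeps the other endpoint reachable. [folklore] -/
theorem rch_step {F : Finset (Sym2 V)} {x u v : V} {e : Sym2 V} (he : e ∈ F) (hu : u ∈ e)
    (hv : v ∈ e) (hxu : Rch F x u) : Rch F x v := by
  by_cases huv : u = v
  · exact huv ▸ hxu
  · have hadj : (SimpleGraph.fromEdgeSet (↑F : Set (Sym2 V))).Adj u v := by
      rw [SimpleGraph.fromEdgeSet_adj]
      refine ⟨?_, huv⟩
      have : e = s(u, v) := (Sym2.mem_and_mem_iff huv).1 ⟨hu, hv⟩
      rw [← this]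
      exact Finset.mem_coe.2 he
    exact SimpleGraph.Reachable.trans hxu hadj.reachable

/-- Adding edges none of whose endpoints is `K`-reachable from `x` does not change what is
reachable from `x`. [folklore] -/
theorem rch_union_iff {K R : Finset (Sym2 V)} {x : V} (hR : ∀ e ∈ R, ∀ v ∈ e, ¬ Rch K x v)
    (v : V) : Rch (K ∪ R) x v ↔ Rch K x v := by
  refine ⟨fun h => ?_, rch_mono subset_union_left⟩
  unfold Rch at h
  rw [SimpleGraph.reachable_iff_reflTransGen] at h
  induction h with
  | refl => exact rch_refl K x
  | tail _ hbc ih =>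
    rw [SimpleGraph.fromEdgeSet_adj] at hbc
    obtain ⟨hmem, _⟩ := hbc
    rcases Finset.mem_union.1 (Finset.mem_coe.1 hmem) with hK | hRR
    · exact rch_step hK (Sym2.mem_mk_left _ _) (Sym2.mem_mk_right _ _) ih
    · exact absurd ih (hR _ hRR _ (Sym2.mem_mk_left _ _))

/-- The edges of `F` in the `F`-component of `x` (both endpoints reachable; one suffices). [folklore] -/
def clusterEdges (F : Finset (Sym2 V)) (x : V) : Finset (Sym2 V) :=
  F.filter fun e => ∃ v ∈ e, Rch F x v

omit [DecidableEq V] in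
/-- The cluster edges are edges of `F`. [folklore] -/
theorem clusterEdges_subset (F : Finset (Sym2 V)) (x : V) : clusterEdges F x ⊆ F :=
  filter_subset _ _

/-- Edges of `F` outside the `x`-cluster touch no vertex reachable from `x`. [folklore] -/
theorem sdiff_clusterEdges_avoid (F : Finset (Sym2 V)) (x : V) :
    ∀ e ∈ F \ clusterEdges F x, ∀ v ∈ e, ¬ Rch (clusterEdges F x) x v := by
  intro e he v hv hr
  rw [mem_sdiff, clusterEdges, mem_filter] at he
  exact he.2 ⟨he.1, v, hv, rch_mono (clusterEdges_subset F x) hr⟩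

/-- Reachability from `x` inside the `x`-cluster edges is reachability inside `F`. [folklore] -/
theorem rch_clusterEdges_iff (F : Finset (Sym2 V)) (x v : V) :
    Rch (clusterEdges F x) x v ↔ Rch F x v := by
  have h := rch_union_iff (sdiff_clusterEdges_avoid F x) v
  rw [union_sdiff_of_subset (clusterEdges_subset F x)] at h
  exact h.symm

/-- Taking cluster edges is idempotent (the `x`-cluster is self-clustered). [folklore] -/
theorem clusterEdges_idem (F : Finset (Sym2 V)) (x : V) :
    clusterEdges (clusterEdges F x) x = clusterEdges F x := by
  ext e
  constructor
  · intro h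
    exact (mem_filter.1 h).1
  · intro h
    have h' := h
    rw [clusterEdges, mem_filter] at h'
    obtain ⟨_, v, hv, hr⟩ := h'
    exact mem_filter.2 ⟨h, v, hv, (rch_clusterEdges_iff F x v).2 hr⟩

/-- Adding edges that avoid the reachable set does not change a self-clustered `K`. [folklore] -/
theorem clusterEdges_union_eq {K R : Finset (Sym2 V)} {x : V} (hK : clusterEdges K x = K)
    (hR : ∀ e ∈ R, ∀ v ∈ e, ¬ Rch K x v) : clusterEdges (K ∪ R) x = K := by
  ext e
  rw [clusterEdges, mem_filter, mem_union]
  simp_rw [rch_union_iff hR]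
  constructor
  · rintro ⟨hKR | hRR, v, hv, hr⟩
    · exact hKR
    · exact absurd hr (hR e hRR v hv)
  · intro he
    refine ⟨Or.inl he, ?_⟩
    have he' : e ∈ clusterEdges K x := by rw [hK]; exact he
    exact (mem_filter.1 he').2

/-- Every endpoint of an edge of a self-clustered `K` is reachable. [folklore] -/
theorem rch_of_mem_of_self {K : Finset (Sym2 V)} {x : V} (hK : clusterEdges K x = K)
    {e : Sym2 V} (he : e ∈ K) {v : V} (hv : v ∈ e) : Rch K x v := by
  have he' : e ∈ clusterEdges K x := by rw [hK]; exact he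
  obtain ⟨-, u, hu, hxu⟩ := mem_filter.1 he'
  exact rch_step he hu hv hxu

/-- `F`-degree of a vertex in an edge finset. [folklore] -/
def edeg (F : Finset (Sym2 V)) (v : V) : ℕ := #(F.filter fun e => v ∈ e)

/-- Degrees add over disjoint edge sets. [folklore] -/
theorem edeg_union {K R : Finset (Sym2 V)} (h : Disjoint K R) (v : V) :
    edeg (K ∪ R) v = edeg K v + edeg R v := by
  unfold edeg
  rw [filter_union, card_union_of_disjoint (disjoint_filter_filter h)]

/-- A vertex on no edge of `R` has `R`-degree `0`. [folklore] -/
theorem edeg_eq_zero_of_avoid {R : Finset (Sym2 V)} {v : V} (h : ∀ e ∈ R, v ∉ e) : edeg R v = 0 := by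
  unfold edeg
  rw [card_eq_zero, filter_eq_empty_iff]
  exact fun e he => h e he

/-- In a self-clustered `K`, unreachable vertices have `K`-degree `0`. [folklore] -/
theorem edeg_eq_zero_of_not_rch {K : Finset (Sym2 V)} {x v : V} (hK : clusterEdges K x = K)
    (hv : ¬ Rch K x v) : edeg K v = 0 :=
  edeg_eq_zero_of_avoid fun _ he hve => hv (rch_of_mem_of_self hK he hve)

/-- In a self-clustered `K`, vertices of positive `K`-degree are reachable. [folklore] -/
theorem rch_of_edeg_ne_zero {K : Finset (Sym2 V)} {x v : V} (hK : clusterEdges K x = K)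
    (hv : edeg K v ≠ 0) : Rch K x v := by
  by_contra h
  exact hv (edeg_eq_zero_of_not_rch hK h)

/-- A self-clustered `K` is disjoint from any edge set avoiding its reachable vertices. [folklore] -/
theorem disjoint_of_avoid {K R : Finset (Sym2 V)} {x : V} (hK : clusterEdges K x = K)
    (hR : ∀ e ∈ R, ∀ v ∈ e, ¬ Rch K x v) : Disjoint K R := by
  rw [Finset.disjoint_left]
  intro e heK heR
  induction e using Sym2.ind with
  | _ a b => exact hR _ heR a (Sym2.mem_mk_left a b) (rch_of_mem_of_self hK heK (Sym2.mem_mk_left a b))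

/-- Handshake: an edge finset without diagonal edges has an even number of odd vertices. [folklore] -/
theorem even_card_odd_edeg [Fintype V] {F : Finset (Sym2 V)} (hdiag : ∀ e ∈ F, ¬ e.IsDiag) :
    Even #(univ.filter fun v => Odd (edeg F v)) := by
  have htwo : ∀ e ∈ F, (Finset.univ.filter fun v : V => v ∈ e).card = 2 := by
    intro e he
    induction e using Sym2.ind with
    | _ a b =>
      have hab : a ≠ b := fun h => hdiag _ he (by simp [h])
      rw [Finset.card_eq_two]
      exact ⟨a, b, hab, by ext v; simp [Sym2.mem_iff]⟩
  have hsum : ∑ v, edeg F v = 2 * F.card := by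
    unfold edeg
    simp_rw [Finset.card_filter]
    rw [Finset.sum_comm]
    simp_rw [← Finset.card_filter]
    rw [Finset.sum_congr rfl htwo, Finset.sum_const, smul_eq_mul, mul_comm]
  have heven : Even (∑ v, edeg F v) := ⟨F.card, by rw [hsum]; ring⟩
  rwa [Finset.even_sum_iff_even_card_odd] at heven
end Graph

/-! ### The fibre bijection `F ↦ F ∖ K`, `R ↦ K ∪ R` over a fixed self-clustered `K` -/

section Fibre
variable {V : Type*} [Fintype V] [DecidableEq V] (G : SimpleGraph V) [DecidableRel G.Adj]

/-- Depleted volume: vertices not `K`-reachable from `x`. [folklore] -/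
def dVol (K : Finset (Sym2 V)) (x : V) : Finset V := univ.filter fun v => ¬ Rch K x v

/-- Membership in the depleted volume: not reachable from `x` inside `K`. [folklore] -/
theorem mem_dVol {K : Finset (Sym2 V)} {x v : V} : v ∈ dVol K x ↔ ¬ Rch K x v := by
  simp [dVol]

/-- Adding edges that avoid the reachable set does not change the depleted volume. [folklore] -/
theorem dVol_union_eq {K R : Finset (Sym2 V)} {x : V} (hR : ∀ e ∈ R, ∀ v ∈ e, ¬ Rch K x v) :
    dVol (K ∪ R) x = dVol K x := by
  ext v; simp only [dVol, mem_filter, mem_univ, true_and, rch_union_iff hR]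

/-- `tJoins G univ S` membership in terms of `edeg`. [folklore] -/
theorem mem_tJoins_univ {S : Finset V} {F : Finset (Sym2 V)} :
    F ∈ tJoins G Set.univ S ↔ F ⊆ G.edgeFinset ∧ ∀ v, Odd (edeg F v) ↔ v ∈ S := by
  rw [mem_tJoins]
  simp only [Set.subset_univ, true_and]
  rfl

/-- **Fibre sum.** Fix a self-clustered `K ⊆ E(G)` at `x` with odd set `S₀` and a terminal set
`T` inside the depleted volume `Λ = dVol K x`.  Then `F ↦ F ∖ K` is a bijection from
`{F ∈ 𝒯_{S₀ ∪ T}(G) : clusterEdges F x = K}` onto `{R ⊆ edgesIn G Λ : oddVerts Λ R = T}`, with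
inverse `R ↦ K ∪ R`. [folklore] -/
theorem fibre_sum {K : Finset (Sym2 V)} {x : V} {S₀ T : Finset V} (hKG : K ⊆ G.edgeFinset)
    (hKself : clusterEdges K x = K) (hKodd : ∀ v, Odd (edeg K v) ↔ v ∈ S₀)
    (hT : T ⊆ dVol K x) (g : Finset (Sym2 V) → ℝ) :
    ∑ F ∈ (tJoins G Set.univ (S₀ ∪ T)).filter (fun F => clusterEdges F x = K), g F =
      ∑ R ∈ (edgesIn G (dVol K x)).powerset.filter (fun R => oddVerts (dVol K x) R = T),
        g (K ∪ R) := by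
  -- vertices of S₀ are reachable
  have hS₀ : ∀ v ∈ S₀, Rch K x v := fun v hv =>
    rch_of_edeg_ne_zero hKself (fun h0 => by
      have := (hKodd v).2 hv; rw [h0] at this; exact Nat.not_odd_zero this)
  refine Finset.sum_bij' (fun F _ => F \ K) (fun R _ => K ∪ R) ?_ ?_ ?_ ?_ ?_
  · -- hi : F ↦ F \ K lands in the even/T-subgraphs of the depleted volume
    intro F hF
    rw [mem_filter] at hF
    obtain ⟨hF, hcl⟩ := hF
    rw [mem_tJoins_univ] at hF
    obtain ⟨hFG, hFodd⟩ := hF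
    have havoid : ∀ e ∈ F \ K, ∀ v ∈ e, ¬ Rch K x v := by
      have := sdiff_clusterEdges_avoid F x
      rw [hcl] at this
      exact this
    have hdisj : Disjoint K (F \ K) := disjoint_sdiff
    have hKF : K ⊆ F := by rw [← hcl]; exact clusterEdges_subset F x
    rw [mem_filter, mem_powerset]
    refine ⟨fun e he => ?_, ?_⟩
    · rw [mem_edgesIn_iff]
      refine ⟨SimpleGraph.mem_edgeFinset.1 (hFG (mem_sdiff.1 he).1), fun v hv => ?_⟩
      exact mem_dVol.2 (havoid e he v hv)
    · ext v
      rw [oddVerts, mem_filter, mem_dVol]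
      constructor
      · rintro ⟨hv, hodd⟩
        have hdeg : edeg F v = edeg K v + edeg (F \ K) v := by
          rw [← edeg_union hdisj, union_sdiff_of_subset hKF]
        rw [edeg_eq_zero_of_not_rch hKself hv, zero_add] at hdeg
        have hodd' : Odd (edeg F v) := by rw [hdeg]; exact hodd
        have hvS := (hFodd v).1 hodd'
        rcases mem_union.1 hvS with h | h
        · exact absurd (hS₀ v h) hv
        · exact h
      · intro hvT
        have hv : ¬ Rch K x v := mem_dVol.1 (hT hvT)
        refine ⟨hv, ?_⟩
        have hdeg : edeg F v = edeg K v + edeg (F \ K) v := by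
          rw [← edeg_union hdisj, union_sdiff_of_subset hKF]
        rw [edeg_eq_zero_of_not_rch hKself hv, zero_add] at hdeg
        have h1 : Odd (edeg F v) := (hFodd v).2 (mem_union_right _ hvT)
        rw [hdeg] at h1
        exact h1
  · -- hj : R ↦ K ∪ R lands in the fibre
    intro R hR
    rw [mem_filter, mem_powerset] at hR
    obtain ⟨hRE, hRodd⟩ := hR
    have havoid : ∀ e ∈ R, ∀ v ∈ e, ¬ Rch K x v := fun e he v hv =>
      mem_dVol.1 ((mem_edgesIn_iff.1 (hRE he)).2 v hv)
    have hdisj : Disjoint K R := by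
      rw [Finset.disjoint_left]
      intro e heK heR
      induction e using Sym2.ind with
      | _ a b => exact havoid _ heR a (Sym2.mem_mk_left a b) (rch_of_mem_of_self hKself heK (Sym2.mem_mk_left a b))
    rw [mem_filter, mem_tJoins_univ]
    refine ⟨⟨?_, fun v => ?_⟩, clusterEdges_union_eq hKself havoid⟩
    · intro e he
      rcases mem_union.1 he with h | h
      · exact hKG h
      · exact SimpleGraph.mem_edgeFinset.2 (mem_edgesIn_iff.1 (hRE h)).1
    · rw [edeg_union hdisj]
      by_cases hv : Rch K x v
      · have h0 : edeg R v = 0 := edeg_eq_zero_of_avoid fun e he hve => havoid e he v hve hv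
        rw [h0, add_zero, hKodd v, mem_union]
        constructor
        · exact Or.inl
        · rintro (h | h)
          · exact h
          · exact absurd hv (mem_dVol.1 (hT h))
      · rw [edeg_eq_zero_of_not_rch hKself hv, zero_add, mem_union]
        have hvΛ : v ∈ dVol K x := mem_dVol.2 hv
        have key : Odd (edeg R v) ↔ v ∈ T := by
          rw [← hRodd, oddVerts, mem_filter]
          exact ⟨fun h => ⟨hvΛ, h⟩, fun h => h.2⟩
        rw [key]
        constructor
        · exact Or.inr
        · rintro (h | h)
          · exact absurd (hS₀ v h) hv
          · exact h
  · -- left inverse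
    intro F hF
    rw [mem_filter] at hF
    have hKF : K ⊆ F := by rw [← hF.2]; exact clusterEdges_subset F x
    exact union_sdiff_of_subset hKF
  · -- right inverse
    intro R hR
    rw [mem_filter, mem_powerset] at hR
    have havoid : ∀ e ∈ R, ∀ v ∈ e, ¬ Rch K x v := fun e he v hv =>
      mem_dVol.1 ((mem_edgesIn_iff.1 (hR.1 he)).2 v hv)
    have hdisj : Disjoint K R := by
      rw [Finset.disjoint_left]
      intro e heK heR
      induction e using Sym2.ind with
      | _ a b => exact havoid _ heR a (Sym2.mem_mk_left a b) (rch_of_mem_of_self hKself heK (Sym2.mem_mk_left a b))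
    exact union_sdiff_cancel_left hdisj
  · -- summand
    intro F hF
    rw [mem_filter] at hF
    have hKF : K ⊆ F := by rw [← hF.2]; exact clusterEdges_subset F x
    rw [union_sdiff_of_subset hKF]
end Fibre

/-! ### Vocabulary used by the sequel files (`PairSplitDeletion`, `TJoinTransport`, `CostumeReduction`) -/

section Vocabulary
variable {V : Type*} [Fintype V] [DecidableEq V] (G : SimpleGraph V) [DecidableRel G.Adj]

/-- The cluster index set: self-clustered `K ⊆ E(G)` at `a₀` with odd set `{a₀, a₁}`, reaching
neither `a₂` nor `a₃`. [folklore] -/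
def clusterIndex (a₀ a₁ a₂ a₃ : V) : Finset (Finset (Sym2 V)) :=
  (G.edgeFinset.powerset).filter fun K => clusterEdges K a₀ = K ∧
    (∀ v, Odd (edeg K v) ↔ v ∈ ({a₀, a₁} : Finset V)) ∧ ¬ Rch K a₀ a₂ ∧ ¬ Rch K a₀ a₃

/-- Membership in the cluster index set, unfolded. [folklore] -/
theorem mem_clusterIndex {a₀ a₁ a₂ a₃ : V} {K : Finset (Sym2 V)} :
    K ∈ clusterIndex G a₀ a₁ a₂ a₃ ↔ K ⊆ G.edgeFinset ∧ clusterEdges K a₀ = K ∧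
      (∀ v, Odd (edeg K v) ↔ v ∈ ({a₀, a₁} : Finset V)) ∧ ¬ Rch K a₀ a₂ ∧ ¬ Rch K a₀ a₃ := by
  rw [clusterIndex, mem_filter, mem_powerset]

/-- The edge map of a vertex bijection. [folklore] -/
def emap (σ : V ≃ V) : Sym2 V ↪ Sym2 V :=
  ⟨Sym2.map σ, Sym2.map.injective σ.injective⟩

omit [Fintype V] [DecidableEq V] in
/-- `emap σ` acts as `Sym2.map σ`. [folklore] -/
@[simp] theorem emap_apply (σ : V ≃ V) (e : Sym2 V) : emap σ e = Sym2.map σ e := rfl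

omit [Fintype V] [DecidableEq V] in
/-- `σ v ∈ σ e ↔ v ∈ e`. [folklore] -/
theorem mem_emap_iff (σ : V ≃ V) (e : Sym2 V) (v : V) : σ v ∈ emap σ e ↔ v ∈ e := by
  rw [emap_apply, Sym2.mem_map]
  constructor
  · rintro ⟨a, ha, hav⟩
    rwa [← σ.injective hav]
  · intro hv
    exact ⟨v, hv, rfl⟩

/-- The clean four-source sum "the `x`-cluster avoids `y` and `z`". [folklore] -/
def Zsp (A : Finset V) (t : ℝ) (x y z : V) : ℝ :=
  ∑ F ∈ (tJoins G Set.univ A).filter (fun F => ¬ Rch F x y ∧ ¬ Rch F x z), t ^ F.card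
end Vocabulary

section BoxFrame
/-- Coordinate permutation of the box `{-N..N}³`, as a bijection of its vertex type. [folklore] -/
def boxPerm (N : ℕ) (π : Equiv.Perm (Fin 3)) : ↥(box 3 N) ≃ ↥(box 3 N) where
  toFun x := ⟨fun i => (x : Site 3) (π i), by
    have hx := x.2
    rw [mem_box] at hx ⊢
    exact fun i => hx (π i)⟩
  invFun x := ⟨fun i => (x : Site 3) (π.symm i), by
    have hx := x.2
    rw [mem_box] at hx ⊢
    exact fun i => hx (π.symm i)⟩
  left_inv x := by ext i; simp
  right_inv x := by ext i; simp

/-- Coordinates of `boxPerm N π x` are those of `x` read through `π`. [folklore] -/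
theorem boxPerm_apply_coe (N : ℕ) (π : Equiv.Perm (Fin 3)) (x : ↥(box 3 N)) :
    ((boxPerm N π x : ↥(box 3 N)) : Site 3) = fun i => (x : Site 3) (π i) := rfl

/-- Precomposition with a coordinate permutation is an order automorphism of `Site 3`. [folklore] -/
def sitePermIso (π : Equiv.Perm (Fin 3)) : Site 3 ≃o Site 3 where
  toFun x := fun i => x (π i)
  invFun x := fun i => x (π.symm i)
  left_inv x := by funext i; simp
  right_inv x := by funext i; simp
  map_rel_iff' := by
    intro x y
    simp only [Equiv.coe_fn_mk, Pi.le_def]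
    exact ⟨fun h i => by simpa using h (π.symm i), fun h i => h (π i)⟩
end BoxFrame

end Summit.CriticalPhenomena.Ising3DConformalLimit.StrandShadowNegative

end
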